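import Summits.HubbardSuperconductivity.HubbardSuperconductivity.Theorems.BalabanIRBirComplexStableXYRHessianOrigin
import Summits.HubbardSuperconductivity.HubbardSuperconductivity.Theorems.BalabanIRBirComplexStableXYFixedVolumeLattice
import HarnessLib

/-!
# Crux `BirComplexStableXYR` (stmt-HubbardSuperconductivity-14845): the real reference Gaussian of an
# admissible table is COERCIVE — `Re Σ_s H_c(0)(u ∘ sh s) ≥ c₀ ×` nearest-neighbour Dirichlet form

Support file (prover seat 0, route BalabanIR) for the restated engine
`…Theses.BalabanIR.BirComplexStableXYR`.  Summing the window statement `cvxr_re_hess_origin_ge`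
(`…HessianOrigin`: (N)+(C) ⇒ `c₀ ΣΣ(v_w - v_w')² ≤ Re H_c(0)v`, `H_c(0)v = -Σ_n c_n (n·v)²`) over the
translates of the space-time torus `(ℤ/L)² × ℤ/M` and keeping, in each window (`r ≥ 2`), only the three
unit steps from the window origin (`birLat_sh_unit` of `…FixedVolumeLattice`):

  `c₀ Σ_s [(u_s - u_{s+E₁})² + (u_s - u_{s+E₂})² + (u_s - u_{s+E₃})²] ≤ Re(-Σ_s Σ_n c_n (n·(u∘sh s))²)`

for every real field `u` (`gaussianCoercive`).  With `…GaussianReality` (the same summed quadratic form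
has zero imaginary part under (R)∧(P)) this is the statement "the reference Gaussian `N(0,(K·Q)⁻¹)` of
the multiscale / log-concave lines is REAL and dominates `c₀ ×` the lattice Laplacian", i.e.
`Q̂(k) ≥ c₀(ε_s(k) + ε_τ(k))` in Fourier variables (idea cards
`Cruxes/BirComplexStableXYR/Ideas/real-covariance-multiscale-port.md`, `…/log-concave-core-bounded-phase.md`);
the anisotropic lattice sum it is paired with is `BirSliceXY.dispersion_sum_bound`. [folklore]
-/

noncomputable section

namespace Summit.HubbardSuperconductivity.HubbardSuperconductivity.Theorems

open scoped BigOperators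
open Summit.HubbardSuperconductivity.BirComplexStableXYNegative
open Literature.Probability.LatticeModels

section GaussianCoercive

variable {r : ℕ}

/-- In a window of side `r ≥ 2`, the complete Dirichlet form of `u ∘ sh s` dominates the three
unit-step squared differences at the window origin. [folklore] -/
theorem gcoer_window_ge_unitSteps (hr : 2 ≤ r) (L M : ℕ) [NeZero L] [NeZero M]
    (u : Λ L M → ℝ) (s : Λ L M) :
    (u s - u (s + (![1, 0], 0))) ^ 2 + (u s - u (s + (![0, 1], 0))) ^ 2 + (u s - u (s + (0, 1))) ^ 2 ≤
      ∑ w : W r, ∑ w' : W r, (u (sh L M s w) - u (sh L M s w')) ^ 2 := by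
  set w₀ : W r := (⟨0, by omega⟩, ⟨0, by omega⟩, ⟨0, by omega⟩) with hw₀
  set e₁ : W r := (⟨1, by omega⟩, ⟨0, by omega⟩, ⟨0, by omega⟩) with he₁
  set e₂ : W r := (⟨0, by omega⟩, ⟨1, by omega⟩, ⟨0, by omega⟩) with he₂
  set e₃ : W r := (⟨0, by omega⟩, ⟨0, by omega⟩, ⟨1, by omega⟩) with he₃
  have h12 : e₁ ≠ e₂ := by simp [he₁, he₂, Fin.ext_iff]
  have h13 : e₁ ≠ e₃ := by simp [he₁, he₃, Fin.ext_iff]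
  have h23 : e₂ ≠ e₃ := by simp [he₂, he₃, Fin.ext_iff]
  obtain ⟨hs0, hs1, hs2, hs3⟩ := birLat_sh_unit (L := L) (M := M) hr (sh := sh L M)
    (fun s w => rfl) s
  set T : W r → W r → ℝ := fun w w' => (u (sh L M s w) - u (sh L M s w')) ^ 2 with hT
  have hT0 : ∀ w w', 0 ≤ T w w' := fun w w' => sq_nonneg _
  have h1 : ∑ w' ∈ ({e₁, e₂, e₃} : Finset (W r)), T w₀ w' ≤ ∑ w', T w₀ w' :=
    Finset.sum_le_sum_of_subset_of_nonneg (Finset.subset_univ _) fun w' _ _ => hT0 w₀ w'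
  have h2 : ∑ w', T w₀ w' ≤ ∑ w, ∑ w', T w w' :=
    Finset.single_le_sum (f := fun w => ∑ w', T w w')
      (fun w _ => Finset.sum_nonneg fun w' _ => hT0 w w') (Finset.mem_univ w₀)
  have h3 : ∑ w' ∈ ({e₁, e₂, e₃} : Finset (W r)), T w₀ w' = T w₀ e₁ + T w₀ e₂ + T w₀ e₃ := by
    rw [Finset.sum_insert (by simp [h12, h13]), Finset.sum_pair h23, add_assoc]
  have h4 : T w₀ e₁ + T w₀ e₂ + T w₀ e₃ =
      (u s - u (s + (![1, 0], 0))) ^ 2 + (u s - u (s + (![0, 1], 0))) ^ 2 +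
        (u s - u (s + (0, 1))) ^ 2 := by
    simp only [hT, hw₀, he₁, he₂, he₃, hs0, hs1, hs2, hs3]
  linarith

/-- **Coercivity of the real reference Gaussian.**  For a table with (N) and (C) (constant `c₀ > 0`,
window side `r ≥ 2`) and every real field `u` on `(ℤ/L)² × ℤ/M`:
`c₀ Σ_s [(u_s - u_{s+E₁})² + (u_s - u_{s+E₂})² + (u_s - u_{s+E₃})²] ≤ Re(-Σ_s Σ_n c_n (n·(u∘sh s))²)`
— the translate-summed real Hessian at the constants dominates `c₀` times the nearest-neighbour
Dirichlet form of the space-time torus. [folklore] -/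
theorem gaussianCoercive (hr : 2 ≤ r) (c : Table r) {c₀ : ℝ} (hc₀ : 0 < c₀)
    (hN : c.sum (fun _ a => a) = 0)
    (hC : ∀ φ : W r → ℝ, c₀ * ∑ w, ∑ w', (1 - Real.cos (φ w - φ w')) ≤ (genF c φ).re)
    (L M : ℕ) [NeZero L] [NeZero M] (u : Λ L M → ℝ) :
    c₀ * ∑ s : Λ L M, ((u s - u (s + (![1, 0], 0))) ^ 2 + (u s - u (s + (![0, 1], 0))) ^ 2 +
        (u s - u (s + (0, 1))) ^ 2) ≤
      (-∑ s : Λ L M, c.sum (fun n a =>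
        a * (((∑ w, (n w : ℝ) * u (sh L M s w)) ^ 2 : ℝ) : ℂ))).re := by
  rw [← Finset.sum_neg_distrib, Complex.re_sum, Finset.mul_sum]
  refine Finset.sum_le_sum fun s _ => ?_
  have hwin := cvxr_re_hess_origin_ge c hc₀ hN hC (fun w => u (sh L M s w))
  have hgeo := gcoer_window_ge_unitSteps hr L M u s
  have := mul_le_mul_of_nonneg_left hgeo hc₀.le
  exact this.trans hwin

end GaussianCoercive

end Summit.HubbardSuperconductivity.HubbardSuperconductivity.Theorems
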